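import Mathlib
import HarnessLib

/-!
# ValiantsHypothesis / LacunarySymmetroid — crux `MatrixDescartes` (stmt-ValiantsHypothesis-18050, V1),
# line `Cruxes/MatrixDescartes/Lines/osculation_law.lean` («osculation-law»), stub `stub_peel` (ALL ranks):
# MULTIPLICITY ACCOUNTING FOR `r` BRANCH FAMILIES (rank-free)

The `r`-branch form of `OsculationPeel.card_add_card_le_card_roots` (`…PeelRankTwoCurve`, two branches): if a
family of finsets `S i ⊆ {t > 0 : p(t) = 0}` (the own cuts of branch `i` at the zeros of a coefficient `p`) charges
each `t` at most `rootMultiplicity p t` times, then `Σ_i #S_i ≤ Z₊mult(p)` — an `m`-fold event (m branches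
vanishing / escaping at the same abscissa) is paid for by multiplicity `m`.  Pure counting (Mathlib only).

Honest framing: a rank-free LEMMA toward the OPEN stub `stub_peel` (all `r`); nothing of the summit is proved;
`VP ≠ VNP` is NOT proved.  No definitions, no named facts.
-/

-- `Summit.ValiantsHypothesis.ValiantsHypothesis.…` is the tree's mandated single-conjunct layout (Sub = Summit).
set_option linter.dupNamespace false

noncomputable section

namespace Summit.ValiantsHypothesis.ValiantsHypothesis.Theorems.LacunarySymmetroidMatrixDescartes

open Polynomial
open scoped BigOperators

namespace OsculationPeel

/-- Double counting: `Σ_{i ∈ s} #S_i = Σ_{t ∈ ⋃ S_i} #{i ∈ s : t ∈ S_i}`. [folklore] -/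
theorem sum_card_eq_sum_card_filter {ι : Type*} [DecidableEq ι] (s : Finset ι) (S : ι → Finset ℝ) :
    ∑ i ∈ s, (S i).card = ∑ t ∈ s.biUnion S, (s.filter (fun i => t ∈ S i)).card := by
  classical
  have h1 : ∀ i ∈ s, (S i).card = ∑ t ∈ s.biUnion S, if t ∈ S i then 1 else 0 := by
    intro i hi
    rw [← Finset.sum_filter, Finset.card_eq_sum_ones]
    refine Finset.sum_congr ?_ fun _ _ => rfl
    ext t
    simp only [Finset.mem_filter, Finset.mem_biUnion]
    exact ⟨fun h => ⟨⟨i, hi, h⟩, h⟩, fun h => h.2⟩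
  rw [Finset.sum_congr rfl h1, Finset.sum_comm]
  refine Finset.sum_congr rfl fun t _ => ?_
  rw [← Finset.sum_filter, Finset.card_eq_sum_ones]

/-- **Multiplicity accounting for `r` branch families**: finsets `S i` of positive roots of `p ≢ 0` charging each
abscissa `t` at most `rootMultiplicity p t` times have total size at most `Z₊mult(p)`. [folklore] -/
theorem sum_card_le_card_roots (p : ℝ[X]) (hp : p ≠ 0) {ι : Type*} [DecidableEq ι] (s : Finset ι)
    (S : ι → Finset ℝ) (hS : ∀ i ∈ s, ∀ t ∈ S i, 0 < t ∧ p.IsRoot t)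
    (hmult : ∀ t, (s.filter (fun i => t ∈ S i)).card ≤ p.rootMultiplicity t) :
    ∑ i ∈ s, (S i).card ≤ Multiset.card (p.roots.filter (fun t => 0 < t)) := by
  classical
  set M := p.roots.filter (fun t => 0 < t) with hM
  have hU : s.biUnion S ⊆ M.toFinset := by
    intro t ht
    obtain ⟨i, hi, hti⟩ := Finset.mem_biUnion.1 ht
    rw [Multiset.mem_toFinset, hM, Multiset.mem_filter, mem_roots hp]
    exact ⟨(hS i hi t hti).2, (hS i hi t hti).1⟩
  have hcount : ∀ t ∈ s.biUnion S, M.count t = p.rootMultiplicity t := by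
    intro t ht
    obtain ⟨i, hi, hti⟩ := Finset.mem_biUnion.1 ht
    rw [hM, Multiset.count_filter_of_pos (hS i hi t hti).1, count_roots]
  calc ∑ i ∈ s, (S i).card = ∑ t ∈ s.biUnion S, (s.filter (fun i => t ∈ S i)).card :=
        sum_card_eq_sum_card_filter s S
    _ ≤ ∑ t ∈ s.biUnion S, M.count t := Finset.sum_le_sum fun t ht => by rw [hcount t ht]; exact hmult t
    _ ≤ ∑ t ∈ M.toFinset, M.count t := Finset.sum_le_sum_of_subset hU
    _ = Multiset.card M := Multiset.toFinset_sum_count_eq M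

end OsculationPeel

end Summit.ValiantsHypothesis.ValiantsHypothesis.Theorems.LacunarySymmetroidMatrixDescartes

end
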